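import Literature.AlgebraicGeometry.Frobenioids.ModelFrobenioidBaseSectionThrough
import Literature.AnabelianGeometry.EtaleTheta.BiKummerDef22Context
import Literature.AnabelianGeometry.EtaleTheta.BiKummerThm44SubNHSatDef22Conj
import Literature.AnabelianGeometry.EtaleTheta.BiKummerThm44SubDef22OuterData
import Literature.AnabelianGeometry.EtaleTheta.BiKummerThm44SubUnitsTransport
import HarnessLib

/-!
# [EtTh] Thm 4.4 (iii): T44-L15b AT THE FAITHFUL [FrdII] Def 2.2 (ii) READING — the closer (modulo the data-level laws)

S. Mochizuki, *The étale theta function …* [MochizukiEtTh2009], Thm 4.4 p.94–95; *The geometry of Frobenioids II*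
[MochizukiFrdII2008], Def 2.2 (i)/(ii) p.17, Thm 2.4 (i) p.19, Thm 1.2 (ii) p.8; *Absolute anabelian geometry*
[MochizukiAbsAnab2004], Lem 1.3.8.

abc-iut-w6-d047 (gen 2 draft, gen 3 closer), T44-L15b E-PART §2 over §1 `BiKummerDef22Context.lean`:
`Thm44Hyp.preservesNHSaturatedBsFld_mkOfConnectedTemperoid_faithful : h.PreservesNHSaturatedBsFld` for the settings
`mkOfConnectedTemperoid` whose free `(N, H)`-saturation slots READ [FrdII] Def 2.2 (ii) through `def22Ctx`, and the
[EtTh] Thm 4.4 (i)∧(ii)∧(iii)∧roots closer at tree vocabulary (`thm44_mkOfConnectedTemperoid_of_baseInj_faithful`,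
abc-iut-w5-d179's p436787 with `h15` discharged).  gen 3: the Ψ-EQUIVARIANCE of the descended `Aut_E`-actions (the
`isoO_smul` field, formerly the datum-level binder `hΨact`) is now a THEOREM — T44-L15b quantifies over FROBENIUS-TRIVIAL
`A″` only, and a Frobenius-trivial (= principal) Galois object is `Aut`-ample ([FrdI] Thm 5.1 (iii) for the model), so
`res : Aut_C(A″) ↠ Aut_E(A″_E)` is SURJECTIVE (`TemperedFrobenioid.resE_surjective_of_mapAut_surjective`) and the law
follows from `hact₁`/`hact₂` and the `res_isoC` square; the four `H^{bs-fld}_⊙` normal/open binders are supplied by the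
theorems `hodotBsFld_normal` / `isOpen_hodotBsFld_of_isOpenMap`.  Proof-only; universe `0` (as `def22Ctx`).  Nothing
here bears on [IUTchIII] Cor 3.12.
-/

noncomputable section

namespace Literature.AnabelianGeometry.EtaleTheta

open CategoryTheory Opposite Literature.AlgebraicGeometry.Frobenioids Literature.AlgebraicGeometry.Frobenioids.QuasiTemperoid
  Literature.AnabelianGeometry.SemiGraphs Literature.AnabelianGeometry.SemiGraphs.GaloisObjects
  Literature.AnabelianGeometry.EtaleTheta.CnstPushforward

namespace TemperedFrobenioid

section Lift

universe u₀ v₀ u v w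

variable {D₀ : Type u₀} [Category.{v₀} D₀] {V : FrdIMonoidStub.{w}} {T : RealifiedDivisorMonoids (D₀ := D₀) V}
  {D : Type u} [Category.{v} D] {VD : FrdICatStub.{u, v, w} D} (C : TemperedFrobenioid T D VD)

/-- **A Frobenius-trivial object of the tempered Frobenioid is `Aut`-ample** ([FrdI] Def 1.2 (iv); Thm 5.1 (iii) for the
model Frobenioid): a Frobenius-trivial object is principal, `A = (A_D, Div_B(b))` (`exists_cls_eq_divB_of_isFrobeniusTrivial`),
and every `g ∈ Aut_D(A_D)` lifts to the automorphism `(1, g, 0, b · (g^* b)⁻¹)` of `A` (`B` group-like by `isUnit_BΛ`) — so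
`Aut_C(A) → Aut_D(A_D)` is surjective.  (Same arrow as abc-iut-w4-d044's `BiKummerSetting.exists_aut_baseMap_eq_of_principal`,
stated for the bare tempered Frobenioid.) [cite: MochizukiFrdI2008, Thm. 5.1 (iii) p.97] -/
theorem exists_aut_mapAut_eq_of_isFrobeniusTrivial (A : C.category) (hA : PreFrobenioid.IsFrobeniusTrivial C.toElem A)
    (g : Aut A.base) : ∃ σ : Aut A, C.baseFunctorOfCategory.mapAut A σ = g := by
  have hBg : Objectwise (fun M _ => IsGroupLike M) C.ratFnFunctor := C.ratFnFunctor_isGroupLike T.isUnit_BΛ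
  obtain ⟨b, hb⟩ := ModelFrobenioid.exists_cls_eq_divB_of_isFrobeniusTrivial A hA
  obtain ⟨w, hw⟩ := (hBg A.base).isUnit (pull C.ratFnFunctor g.hom b)
  let lift : A ⟶ A := ModelFrobenioid.mkHom A A 1 g.hom 1 (b * ↑w⁻¹) (by
    rw [PNat.one_coe, pow_one, map_one, mul_one, hb, ModelFrobenioid.pullGp_divB_pull, ← hw, ← map_mul,
      mul_left_comm, Units.mul_inv, mul_one])
  haveI : IsIso (ModelFrobenioid.baseMap lift) := by
    change IsIso g.hom
    infer_instance
  haveI : IsIso lift := ModelFrobenioid.isIso_of hBg lift rfl rfl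
  exact ⟨asIso lift, Iso.ext rfl⟩

/-- `Aut_C(A) → Aut_D(A_D)` is surjective for a Frobenius-trivial `A` (`exists_aut_mapAut_eq_of_isFrobeniusTrivial`).
[cite: MochizukiFrdI2008, Thm. 5.1 (iii) p.97] -/
theorem mapAut_surjective_of_isFrobeniusTrivial (A : C.category) (hA : PreFrobenioid.IsFrobeniusTrivial C.toElem A) :
    Function.Surjective (C.baseFunctorOfCategory.mapAut A) := fun g =>
  C.exists_aut_mapAut_eq_of_isFrobeniusTrivial A hA g

end Lift

variable {K : Type} [Field K] (X : TemperedArithmeticGroup.{0} K) {D₀ : Type} [Category.{0} D₀]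
  {V : FrdIMonoidStub.{0}} {T₀ : RealifiedDivisorMonoids (D₀ := D₀) V}
  {VD : FrdICatStub.{1, 0, 0} (ConnectedPart (BTemp X.Pi))}
  (tf : TemperedFrobenioid T₀ (ConnectedPart (BTemp X.Pi)) VD) (haug : IsOpenMap X.aug)

/-- **`res : Aut_C(A) → Aut_E(A_E)` is SURJECTIVE at an `Aut`-ample Galois object** ([FrdII] Def 2.2 (i): «`G_A ↪ Aut_E(A_E)`
… is an isomorphism if, for instance, `A_D` is Galois [where we recall that `C` is Aut-ample]»): every element of
`Aut_E(aug_* A^bs)` is `outerRep A (aug g)` (`outerRep` surjective, `aug` surjective) `= aug_*(galoisSurjOf g)` (`outerRep_aug`),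
and `galoisSurjOf g ∈ Aut_D(A^bs)` lifts to `Aut_C(A)` by `Aut`-ampleness. [cite: MochizukiFrdII2008, Def 2.2 (i) p.17] -/
theorem resE_surjective_of_mapAut_surjective (A : tf.category) (hA : IsGaloisObj A.base.obj)
    (hlift : Function.Surjective (tf.baseFunctorOfCategory.mapAut A)) :
    Function.Surjective (resE X tf haug A) := by
  intro τ
  obtain ⟨x, hx⟩ := (outerRep_spec X tf haug A hA).2.1 τ
  obtain ⟨g, rfl⟩ := X.aug_surjective x
  rw [outerRep_aug X tf haug A hA] at hx
  obtain ⟨α, hα⟩ := hlift (((connectedObjects (BTemp X.Pi)).fullyFaithfulι.autMulEquivOfFullyFaithful A.base).symm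
    (galoisSurjOf X.isTempered A.base.obj hA g))
  refine ⟨α, ?_⟩
  rw [← hx, ← hα]
  rfl

end TemperedFrobenioid

namespace BiKummerSetting

/-- `σ ↦ e⁻¹ ∘ Ψ(σ) ∘ e` is a group homomorphism `Aut(A) → Aut(B)`: it carries `α u α⁻¹` to the conjugate of the images
(bookkeeping for the Ψ-equivariance of the descended actions; stated over bare categories so that it applies by `exact`
across the definitional identifications `S.C = tf.category`). [cite: MochizukiEtTh2009, Thm 4.4 p.94] -/
private theorem conjAut_mapAut_conj {C₁ : Type*} [Category C₁] {C₂ : Type*} [Category C₂] (F : C₁ ⥤ C₂) {A : C₁}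
    {B : C₂} (e : F.obj A ≅ B) (α u : Aut A) :
    e.conjAut (F.mapAut A (α * u * α⁻¹)) =
      e.conjAut (F.mapAut A α) * e.conjAut (F.mapAut A u) * (e.conjAut (F.mapAut A α))⁻¹ := by
  simp only [map_mul, map_inv]

variable {K : Type} [Field K] {K' : Type} [Field K'] {X₁ : SemiGraphs.TemperedArithmeticGroup.{0} K}
  {X₂ : SemiGraphs.TemperedArithmeticGroup.{0} K'} {D₀ : Type} [Category.{0} D₀] {D₀' : Type}
  [Category.{0} D₀'] {V : FrdIMonoidStub.{0}} {T₁ : RealifiedDivisorMonoids (D₀ := D₀) V}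
  {T₂ : RealifiedDivisorMonoids (D₀ := D₀') V}
  {VD₁ : FrdICatStub.{1, 0, 0} (ConnectedPart (BTemp X₁.Pi))}
  {VD₂ : FrdICatStub.{1, 0, 0} (ConnectedPart (BTemp X₂.Pi))}
  {tf₁ : TemperedFrobenioid T₁ (ConnectedPart (BTemp X₁.Pi)) VD₁} {hZ₁ : tf₁.monoidType = MonoidType.Z}
  {hP₁ : ∀ A : (ConnectedPart (BTemp X₁.Pi))ᵒᵖ, IsPerfect (tf₁.Φ.carrier A)}
  {NH₁ : Subgroup (Field.absoluteGaloisGroup K) → tf₁.category → ℕ+ → Prop} {A₁ : tf₁.category}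
  {hA₁ : PreFrobenioid.IsFrobeniusTrivial tf₁.toElem A₁} {hA₁' : SemiGraphs.IsGaloisObj A₁.base.obj}
  {tf₂ : TemperedFrobenioid T₂ (ConnectedPart (BTemp X₂.Pi)) VD₂} {hZ₂ : tf₂.monoidType = MonoidType.Z}
  {hP₂ : ∀ B : (ConnectedPart (BTemp X₂.Pi))ᵒᵖ, IsPerfect (tf₂.Φ.carrier B)}
  {NH₂ : Subgroup (Field.absoluteGaloisGroup K') → tf₂.category → ℕ+ → Prop} {A₂ : tf₂.category}
  {hA₂ : PreFrobenioid.IsFrobeniusTrivial tf₂.toElem A₂} {hA₂' : SemiGraphs.IsGaloisObj A₂.base.obj}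

/-- **T44-L15b `Thm44Hyp.PreservesNHSaturatedBsFld` AT THE FAITHFUL [FrdII] Def 2.2 (ii) READING, at the genuine connected
base `B^temp(Π^tp_X)⁰` (abc-iut-L2-t4's `mkOfConnectedTemperoid`), for ANY `h : Thm44Hyp`** — «it is immediate from the
manifestly category-theoretic nature of conditions (a), (b), (c) that Ψ preserves (N,H)-saturated objects» ([FrdII] Thm 2.4
(i), abc-iut-L1-d4's `Def22Context.Iso.isNHSaturated_iff`) once `Ψ` is known to induce an isomorphism of the Def 2.2
contexts up to inner automorphism (`saturationConjugationInvariant_holds`), and EVERY Ψ-induced field of that isomorphism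
is a theorem of the tree: `isoG`/`map_H` ([AbsAnab] Lem 1.3.8 ∀-form `hΔ` + open augmentations,
`BiKummerThm44SubGaloisDescent`), `isoE`/`outer_isoG`/`res_isoC`/`isGalois_iff` (the Ψ^bs pin, the push-forward square,
`BiKummerThm44SubDef22OuterData`), `isoC`/`isoO` (`BiKummerThm44SubUnitsTransport`), and `isoO_smul` (Ψ-equivariance of
the descended actions: `A″` is Frobenius-trivial, hence principal and `Aut`-ample — `mapAut_surjective_of_isFrobeniusTrivial` — so
`res₁ : Aut_{C₁}(A″) ↠ Aut_{E₁}(A″_E)` is surjective, `resE_surjective_of_mapAut_surjective`, and the law is `hact₁`/`hact₂`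
transported through the `res_isoC` square).  RESIDUAL BINDERS: the reading `hNH_i` of the free slots through `def22Ctx`
(this IS the faithful reading; `H := H^{bs-fld}_⊙` with its normality/openness THEOREMS `hodotBsFld_normal` /
`isOpen_hodotBsFld_of_isOpenMap`) and the descended actions `act_i` with their law `hact_i` ([FrdII] Thm 1.2 (ii) for the
hull — the one datum the typed interface `Def22Context` asks beyond the tree).  Non-Galois `A″`: neither context is
saturated (condition (b)), Galois-ness being reflected by `Ψ` (`isGaloisObj_base_iff_mkOfConnectedTemperoid`).
[cite: MochizukiEtTh2009, Thm 4.4 (iii) p.95] -/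
theorem Thm44Hyp.preservesNHSaturatedBsFld_mkOfConnectedTemperoid_faithful
    (h : Thm44Hyp (mkOfConnectedTemperoid X₁ tf₁ hZ₁ hP₁ NH₁ A₁ hA₁ hA₁')
      (mkOfConnectedTemperoid X₂ tf₂ hZ₂ hP₂ NH₂ A₂ hA₂ hA₂'))
    (hΔ : ∀ θ : X₁.Pi ≃ₜ* X₂.Pi, X₁.delta.map θ.toMulEquiv.toMonoidHom = X₂.delta)
    (haug₁ : IsOpenMap X₁.aug) (haug₂ : IsOpenMap X₂.aug)
    (act₁ : ∀ A : tf₁.category, MulDistribMulAction (Aut (TemperedFrobenioid.AE X₁ tf₁ haug₁ A)) ↥(tf₁.units A))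
    (hact₁ : ∀ (A : tf₁.category) (α : Aut A) (u : ↥(tf₁.units A)),
      (TemperedFrobenioid.resE X₁ tf₁ haug₁ A α) • u =
        (⟨α * u.1 * α⁻¹, (tf₁.units_normal A).conj_mem _ u.2 α⟩ : ↥(tf₁.units A)))
    (act₂ : ∀ B : tf₂.category, MulDistribMulAction (Aut (TemperedFrobenioid.AE X₂ tf₂ haug₂ B)) ↥(tf₂.units B))
    (hact₂ : ∀ (B : tf₂.category) (α : Aut B) (u : ↥(tf₂.units B)),
      (TemperedFrobenioid.resE X₂ tf₂ haug₂ B α) • u =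
        (⟨α * u.1 * α⁻¹, (tf₂.units_normal B).conj_mem _ u.2 α⟩ : ↥(tf₂.units B)))
    -- the READING of the two free slots through the contexts ([FrdII] Def 2.2 (ii) verbatim), at `H := H^{bs-fld}_⊙`
    (hNH₁ : ∀ (A : tf₁.category) (N : ℕ+),
      NH₁ (mkOfConnectedTemperoid X₁ tf₁ hZ₁ hP₁ NH₁ A₁ hA₁ hA₁').HodotBsFld A N ↔
        PadicKummer.IsNHSaturated (TemperedFrobenioid.def22Ctx X₁ tf₁ haug₁ A (act₁ A) (hact₁ A)
          (mkOfConnectedTemperoid X₁ tf₁ hZ₁ hP₁ NH₁ A₁ hA₁ hA₁').HodotBsFld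
          (mkOfConnectedTemperoid X₁ tf₁ hZ₁ hP₁ NH₁ A₁ hA₁ hA₁').hodotBsFld_normal
          ((mkOfConnectedTemperoid X₁ tf₁ hZ₁ hP₁ NH₁ A₁ hA₁ hA₁').isOpen_hodotBsFld_of_isOpenMap h.isOpen_Hodot₁ haug₁)) N)
    (hNH₂ : ∀ (B : tf₂.category) (N : ℕ+),
      NH₂ (mkOfConnectedTemperoid X₂ tf₂ hZ₂ hP₂ NH₂ A₂ hA₂ hA₂').HodotBsFld B N ↔
        PadicKummer.IsNHSaturated (TemperedFrobenioid.def22Ctx X₂ tf₂ haug₂ B (act₂ B) (hact₂ B)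
          (mkOfConnectedTemperoid X₂ tf₂ hZ₂ hP₂ NH₂ A₂ hA₂ hA₂').HodotBsFld
          (mkOfConnectedTemperoid X₂ tf₂ hZ₂ hP₂ NH₂ A₂ hA₂ hA₂').hodotBsFld_normal
          ((mkOfConnectedTemperoid X₂ tf₂ hZ₂ hP₂ NH₂ A₂ hA₂ hA₂').isOpen_hodotBsFld_of_isOpenMap h.isOpen_Hodot₂ haug₂)) N) :
    h.PreservesNHSaturatedBsFld := by
  intro A'' B'' N hft hisom
  obtain ⟨e⟩ := hisom
  change NH₁ _ A'' N ↔ NH₂ _ B'' N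
  rw [hNH₁, hNH₂]
  by_cases hA : SemiGraphs.IsGaloisObj A''.base.obj
  · -- the context isomorphism `ctx₁ A″ ⥲ (ctx₂ B″).conjOuter c`
    obtain ⟨hB, ι, E, c, hιH, hc, hres⟩ := h.exists_def22OuterData_res_mkOfConnectedTemperoid hΔ haug₁ haug₂ A'' hA
      B'' e (TemperedFrobenioid.outerRep_aug X₁ tf₁ haug₁ A'' hA)
      (fun hB g => TemperedFrobenioid.outerRep_aug X₂ tf₂ haug₂ B'' hB g)
    obtain ⟨isoO, hisoO⟩ := h.exists_unitsEquiv e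
    -- `A″` Frobenius-trivial (= principal) ⇒ `Aut`-ample ⇒ `res₁ : Aut_{C₁}(A″) ↠ Aut_{E₁}(A″_E)` SURJECTIVE (A″ Galois)
    have hsurj : Function.Surjective (TemperedFrobenioid.resE X₁ tf₁ haug₁ A'') :=
      TemperedFrobenioid.resE_surjective_of_mapAut_surjective X₁ tf₁ haug₁ A'' hA
        (tf₁.mapAut_surjective_of_isFrobeniusTrivial A'' hft)
    have hres' : ∀ α : Aut A'', E (TemperedFrobenioid.resE X₁ tf₁ haug₁ A'' α) =
        TemperedFrobenioid.resE X₂ tf₂ haug₂ B'' (e.conjAut (h.Ψ.functor.mapAut A'' α)) := hres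
    -- Ψ-EQUIVARIANCE of the descended `Aut_E`-actions (the former binder `hΨact`), from `hact₁`/`hact₂` through the square
    have key : ∀ (τ : Aut (TemperedFrobenioid.AE X₁ tf₁ haug₁ A'')) (u : ↥(tf₁.units A'')) (v : ↥(tf₂.units B'')),
        v.1 = e.conjAut (h.Ψ.functor.mapAut A'' u.1) →
        letI := act₁ A''; letI := act₂ B''
        (E τ • v).1 = e.conjAut (h.Ψ.functor.mapAut A'' (τ • u).1) := by
      intro τ u v hv
      letI := act₁ A''; letI := act₂ B''
      obtain ⟨α, rfl⟩ := hsurj τ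
      rw [hres' α, hact₂ B'' _ v, hact₁ A'' α u]
      simp only [hv]
      exact (conjAut_mapAut_conj h.Ψ.functor e α u.1).symm
    rw [PadicKummer.saturationConjugationInvariant_holds
      (TemperedFrobenioid.def22Ctx X₂ tf₂ haug₂ B'' (act₂ B'') (hact₂ B'') _ _ _) N c]
    refine PadicKummer.Def22Context.Iso.isNHSaturated_iff (X₁ := TemperedFrobenioid.def22Ctx X₁ tf₁ haug₁ A''
      (act₁ A'') (hact₁ A'') _ _ _) ?_ N
    exact
      { isoC := (h.Ψ.fullyFaithfulFunctor.autMulEquivOfFullyFaithful A'').trans (Iso.conjAut e)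
        isoO := isoO
        isoE := E
        isoG := ι
        res_isoC := fun α => (hres α).symm
        isoO_smul := fun τ u => by
          apply Subtype.ext
          have := key τ u (isoO u) (hisoO u)
          exact (hisoO _).trans this.symm
        outer_isoG := fun g => by
          change (MulAut.conj (TemperedFrobenioid.outerRep X₂ tf₂ haug₂ B'' c)).toMonoidHom.comp
              (TemperedFrobenioid.outerRep X₂ tf₂ haug₂ B'') (ι g) = E (TemperedFrobenioid.outerRep X₁ tf₁ haug₁ A'' g)
          rw [hc, MonoidHom.comp_apply, MulEquiv.coe_toMonoidHom, MulAut.conj_apply]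
        map_H := hιH
        isGalois_iff := ⟨fun _ => hB, fun _ => hA⟩ }
  · -- neither side is Galois: neither context is saturated
    have hB : ¬ SemiGraphs.IsGaloisObj B''.base.obj :=
      fun hB => hA ((h.isGaloisObj_base_iff_mkOfConnectedTemperoid A'' B'' e).2 hB)
    exact ⟨fun hs => (hA hs.galois).elim, fun hs => (hB hs.galois).elim⟩



/-! ### The [EtTh] Thm 4.4 closer at TREE VOCABULARY (abc-iut-w5-d179's base-image consolidation, p436787) -/

section TreeVocab

variable {Kt : Type} [Field Kt] {Kt' : Type} [Field Kt'] {Y₁ : SemiGraphs.TemperedArithmeticGroup.{0} Kt}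
  {Y₂ : SemiGraphs.TemperedArithmeticGroup.{0} Kt'} {E₀ : Type} [Category.{0} E₀] {E₀' : Type}
  [Category.{0} E₀'] {U₁ : RealifiedDivisorMonoids (D₀ := E₀) treeMonoidVocab.{0}}
  {U₂ : RealifiedDivisorMonoids (D₀ := E₀') treeMonoidVocab.{0}}
  {IsRational₁ IsStrictlyRational₁ : ((ConnectedPart (BTemp Y₁.Pi))ᵒᵖ ⥤ CommMonCat.{0}) → Prop}
  {IsRational₂ IsStrictlyRational₂ : ((ConnectedPart (BTemp Y₂.Pi))ᵒᵖ ⥤ CommMonCat.{0}) → Prop}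
  {sf₁ : TemperedFrobenioid U₁ (ConnectedPart (BTemp Y₁.Pi))
    (treeCatVocab (ConnectedPart (BTemp Y₁.Pi)) IsRational₁ IsStrictlyRational₁)}
  {hZ₁ : sf₁.monoidType = MonoidType.Z} {hP₁ : ∀ A : (ConnectedPart (BTemp Y₁.Pi))ᵒᵖ, IsPerfect (sf₁.Φ.carrier A)}
  {NH₁ : Subgroup (Field.absoluteGaloisGroup Kt) → sf₁.category → ℕ+ → Prop} {A₁ : sf₁.category}
  {hA₁ : PreFrobenioid.IsFrobeniusTrivial sf₁.toElem A₁} {hA₁' : SemiGraphs.IsGaloisObj A₁.base.obj}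
  {sf₂ : TemperedFrobenioid U₂ (ConnectedPart (BTemp Y₂.Pi))
    (treeCatVocab (ConnectedPart (BTemp Y₂.Pi)) IsRational₂ IsStrictlyRational₂)}
  {hZ₂ : sf₂.monoidType = MonoidType.Z} {hP₂ : ∀ B : (ConnectedPart (BTemp Y₂.Pi))ᵒᵖ, IsPerfect (sf₂.Φ.carrier B)}
  {NH₂ : Subgroup (Field.absoluteGaloisGroup Kt') → sf₂.category → ℕ+ → Prop} {A₂ : sf₂.category}
  {hA₂ : PreFrobenioid.IsFrobeniusTrivial sf₂.toElem A₂} {hA₂' : SemiGraphs.IsGaloisObj A₂.base.obj}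

/-- **[EtTh] Thm 4.4 (i) ∧ (ii) ∧ (iii) ∧ (`N`-th roots) at the GENUINE connected base with T44-L15b AT THE FAITHFUL READING,
ASSEMBLED** — abc-iut-w5-d179's `thm44_mkOfConnectedTemperoid_of_baseInj` (p436787) with its binder `h15` DISCHARGED by
`preservesNHSaturatedBsFld_mkOfConnectedTemperoid_faithful`: residual = {«`C_i` Frobenioid», T44-L03, `hBD₁`/`hBD₂`} ∪
{hΔ, haug×2, act/hact×2, readings hNH×2}. [cite: MochizukiEtTh2009, Thm 4.4 p.94] -/
theorem Thm44Hyp.thm44_mkOfConnectedTemperoid_of_baseInj_faithful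
    (h : Thm44Hyp (mkOfConnectedTemperoid Y₁ sf₁ hZ₁ hP₁ NH₁ A₁ hA₁ hA₁')
      (mkOfConnectedTemperoid Y₂ sf₂ hZ₂ hP₂ NH₂ A₂ hA₂ hA₂'))
    (hF₁ : PreFrobenioid.IsFrobenioid sf₁.toElem) (hF₂ : PreFrobenioid.IsFrobenioid sf₂.toElem)
    (h3 : h.PreservesFrobeniusStructure)
    (hBD₁ : ∀ {A B : ConnectedPart (BTemp Y₁.Pi)} (α : B ⟶ A),
      Function.Injective (U₁.BΛ.map (sf₁.base.map α).op).hom)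
    (hBD₂ : ∀ {A B : ConnectedPart (BTemp Y₂.Pi)} (α : B ⟶ A),
      Function.Injective (U₂.BΛ.map (sf₂.base.map α).op).hom)
    (hΔ : ∀ θ : Y₁.Pi ≃ₜ* Y₂.Pi, Y₁.delta.map θ.toMulEquiv.toMonoidHom = Y₂.delta)
    (haug₁ : IsOpenMap Y₁.aug) (haug₂ : IsOpenMap Y₂.aug)
    (act₁ : ∀ A : sf₁.category, MulDistribMulAction (Aut (TemperedFrobenioid.AE Y₁ sf₁ haug₁ A)) ↥(sf₁.units A))
    (hact₁ : ∀ (A : sf₁.category) (α : Aut A) (u : ↥(sf₁.units A)),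
      (TemperedFrobenioid.resE Y₁ sf₁ haug₁ A α) • u =
        (⟨α * u.1 * α⁻¹, (sf₁.units_normal A).conj_mem _ u.2 α⟩ : ↥(sf₁.units A)))
    (act₂ : ∀ B : sf₂.category, MulDistribMulAction (Aut (TemperedFrobenioid.AE Y₂ sf₂ haug₂ B)) ↥(sf₂.units B))
    (hact₂ : ∀ (B : sf₂.category) (α : Aut B) (u : ↥(sf₂.units B)),
      (TemperedFrobenioid.resE Y₂ sf₂ haug₂ B α) • u =
        (⟨α * u.1 * α⁻¹, (sf₂.units_normal B).conj_mem _ u.2 α⟩ : ↥(sf₂.units B)))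
    (hNH₁ : ∀ (A : sf₁.category) (N : ℕ+),
      NH₁ (mkOfConnectedTemperoid Y₁ sf₁ hZ₁ hP₁ NH₁ A₁ hA₁ hA₁').HodotBsFld A N ↔
        PadicKummer.IsNHSaturated (TemperedFrobenioid.def22Ctx Y₁ sf₁ haug₁ A (act₁ A) (hact₁ A)
          (mkOfConnectedTemperoid Y₁ sf₁ hZ₁ hP₁ NH₁ A₁ hA₁ hA₁').HodotBsFld
          (mkOfConnectedTemperoid Y₁ sf₁ hZ₁ hP₁ NH₁ A₁ hA₁ hA₁').hodotBsFld_normal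
          ((mkOfConnectedTemperoid Y₁ sf₁ hZ₁ hP₁ NH₁ A₁ hA₁ hA₁').isOpen_hodotBsFld_of_isOpenMap h.isOpen_Hodot₁ haug₁)) N)
    (hNH₂ : ∀ (B : sf₂.category) (N : ℕ+),
      NH₂ (mkOfConnectedTemperoid Y₂ sf₂ hZ₂ hP₂ NH₂ A₂ hA₂ hA₂').HodotBsFld B N ↔
        PadicKummer.IsNHSaturated (TemperedFrobenioid.def22Ctx Y₂ sf₂ haug₂ B (act₂ B) (hact₂ B)
          (mkOfConnectedTemperoid Y₂ sf₂ hZ₂ hP₂ NH₂ A₂ hA₂ hA₂').HodotBsFld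
          (mkOfConnectedTemperoid Y₂ sf₂ hZ₂ hP₂ NH₂ A₂ hA₂ hA₂').hodotBsFld_normal
          ((mkOfConnectedTemperoid Y₂ sf₂ hZ₂ hP₂ NH₂ A₂ hA₂ hA₂').isOpen_hodotBsFld_of_isOpenMap h.isOpen_Hodot₂ haug₂)) N) :
    Thm44_i h ∧ Thm44_ii h (h.psiModel hF₁ hF₂ h3) ∧ Thm44_iii h (h.psiModel hF₁ hF₂ h3) ∧
      h.PreservesNthRoots (h.psiModel hF₁ hF₂ h3) (fun φ f => sf₁.pullFracModel φ f)
        (fun φ f => sf₂.pullFracModel φ f) :=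
  h.thm44_mkOfConnectedTemperoid_of_baseInj _ _ _ _ _ _ _ _ _ _ _ _ _ _ hF₁ hF₂ h3 hBD₁ hBD₂
    (h.preservesNHSaturatedBsFld_mkOfConnectedTemperoid_faithful hΔ haug₁ haug₂ act₁ hact₁ act₂ hact₂ hNH₁ hNH₂)

end TreeVocab

end BiKummerSetting

end Literature.AnabelianGeometry.EtaleTheta

end
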